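import Summits.Parity.GeneralizedHardyLittlewood.Theorems.LeeYangFibresAbsoluteUpgradeModGammaAdjointEqHalfPlane
import HarnessLib

/-!
# Route `LeeYangFibres`, crux `AbsoluteUpgrade` (stmt-Parity-14116), line
# `dip-margin-rate-exchange`: the adjoint method for `ModGammaDisc` — the invariant's value on the
# half-plane `Re z > -1` (helper for the stub `mg_invariantValue`)

Helper file for the registered stub `mg_invariantValue : MGEin → MGAdjointEq → MGInvariantValue` of
the line's vocabulary `LeeYangFibresAbsoluteUpgradeModGammaDefs.lean` (the initial-value theorem of
the real-variable ADJOINT METHOD of the sieve literature [Greaves2001, §4.2.3–4.2.4], here for the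
`Γ`-normalised regularised adjoint `g̃_z = adjTilde N z` of the Buchstab–Dickman row):

* STEP 1, `InvVal.tendsto_mul_adjTilde_of_adjointEq` — from the adjoint equation
  `(w g̃_z(w))' = -z g̃_z(w+1)` (`MGAdjointEq`) and the fundamental theorem of calculus,
  `t g̃_z(t) = g̃_z(1) + z ∫_t^1 g̃_z(w+1) dw → g̃_z(1) + z ∫_0^1 g̃_z(w+1) dw` as `t → 0⁺`;
* STEP 2, `InvVal.tendsto_mul_adjTilde_of_re_gt` — for `Re z > -1`, `t g̃_z(t) → 1/Γ(1+z)`: by the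
  half-plane representation `g̃_z(t) = e^{γz}Γ(1+z)⁻¹∫_0^∞ e^{-tx} x^z φ_z(x) dx`
  (`AdjEq.adjTilde_eq_of_re_gt`), the substitution `x = y/t`, the closed form
  `x^z φ_z(x) = exp(-z(γ + E₁(x)))` (tree `Literature.NumberTheory.Sieve.ein_eq_add`:
  `Ein = γ + log + E₁`), `E₁(y/t) → 0` (tree `tendsto_expIntegralE1_atTop`) and dominated
  convergence with the majorant `e · e^{-y}(1 + y^{-a})`, `a = max(0, -Re z) < 1`;
* `mg_invariantValue_halfplane` (registered helper) — uniqueness of limits: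
  `g̃_z(1) + z ∫_0^1 g̃_z(t+1) dt = 1/Γ(1+z)` for `N ≥ 1`, `|z| ≤ N - 1`, `Re z > -1`.

The extension to the whole disc `|z| ≤ N - 1` (analytic continuation in `z`) is the business of
`LeeYangFibresAbsoluteUpgradeModGammaInvariantValue.lean`.

References: G. Greaves, *Sieves in Number Theory* (2001), §4.2.3–§4.2.4 [Greaves2001] (adjoint
functions; initial values via `Ein = γ + log + E₁`); the tree's
`Literature/NumberTheory/Sieve/EulerMascheroniEin.lean` (`rosserAdjointP_one_one`, the `z = 1`
template).
-/

noncomputable section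

namespace Summit.Parity.GeneralizedHardyLittlewood.Cruxes.AbsoluteUpgrade.DipMarginRateExchange

open scoped BigOperators
open MeasureTheory Set Filter Topology
open Literature.NumberTheory.Sieve (ein einKernel expIntegralE1)

namespace InvVal

/-! ## Step 1: the invariant is the limit of `t · g̃_z(t)` at `0⁺` (adjoint equation + FTC) -/

/-- If `w ↦ w · f(w)` is differentiable at every `v > 0`, then `f` is continuous on `(0, ∞)`. -/
theorem continuousOn_of_hasDerivAt_mul {f f' : ℝ → ℂ}
    (h : ∀ v : ℝ, 0 < v → HasDerivAt (fun w : ℝ => (w : ℂ) * f w) (f' v) v) :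
    ContinuousOn f (Ioi 0) := by
  intro v hv
  have hv' : 0 < v := hv
  have h1 : ContinuousAt (fun w : ℝ => (w : ℂ) * f w) v := (h v hv').continuousAt
  have h2 : ContinuousAt (fun w : ℝ => ((w : ℂ))⁻¹) v :=
    (Complex.continuous_ofReal.continuousAt).inv₀ (Complex.ofReal_ne_zero.mpr hv'.ne')
  have h3 : ContinuousAt (fun w : ℝ => ((w : ℂ))⁻¹ * ((w : ℂ) * f w)) v := h2.mul h1
  have heq : (fun w : ℝ => ((w : ℂ))⁻¹ * ((w : ℂ) * f w)) =ᶠ[𝓝 v] f := by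
    filter_upwards [Ioi_mem_nhds hv'] with w hw
    rw [← mul_assoc, inv_mul_cancel₀ (Complex.ofReal_ne_zero.mpr (ne_of_gt hw)), one_mul]
  exact (h3.congr heq).continuousWithinAt

/-- **Step 1 (FTC reduction).** From the adjoint equation `(w g̃_z(w))' = -z g̃_z(w+1)` on `(0, ∞)`:
`t g̃_z(t) = g̃_z(1) + z ∫_t^1 g̃_z(w+1) dw` for `0 < t ≤ 1`, hence `t g̃_z(t) → g̃_z(1) + z ∫_0^1
g̃_z(w+1) dw` as `t → 0⁺`. -/
theorem tendsto_mul_adjTilde_of_adjointEq (hEq : MGAdjointEq) {N : ℕ} (hN : 1 ≤ N) {z : ℂ}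
    (hz : ‖z‖ ≤ (N : ℝ) - 1) :
    Tendsto (fun t : ℝ => (t : ℂ) * adjTilde N z t) (𝓝[>] 0)
      (𝓝 (adjTilde N z 1 + z * ∫ t in (0 : ℝ)..1, adjTilde N z (t + 1))) := by
  have hD := hEq N hN z hz
  have hcont : ContinuousOn (adjTilde N z) (Ioi 0) := continuousOn_of_hasDerivAt_mul hD
  have hh : ContinuousOn (fun w : ℝ => adjTilde N z (w + 1)) (Ici 0) :=
    hcont.comp (continuous_id.add continuous_const).continuousOn fun w (hw : 0 ≤ w) =>
      show 0 < w + 1 by linarith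
  have hFTC : ∀ t ∈ Ioc (0:ℝ) 1, (t : ℂ) * adjTilde N z t =
      adjTilde N z 1 + z * ∫ w in t..1, adjTilde N z (w + 1) := by
    intro t ht
    have hderiv : ∀ x ∈ uIcc t 1, HasDerivAt (fun w : ℝ => (w : ℂ) * adjTilde N z w)
        (-z * adjTilde N z (x + 1)) x := by
      intro x hx
      rw [uIcc_of_le ht.2] at hx
      exact hD x (lt_of_lt_of_le ht.1 hx.1)
    have hint : IntervalIntegrable (fun x => -z * adjTilde N z (x + 1)) volume t 1 := by
      refine ContinuousOn.intervalIntegrable ?_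
      rw [uIcc_of_le ht.2]
      exact (continuousOn_const.mul hh).mono fun x hx => show 0 ≤ x from le_trans ht.1.le hx.1
    have h := intervalIntegral.integral_eq_sub_of_hasDerivAt hderiv hint
    simp only [intervalIntegral.integral_const_mul, Complex.ofReal_one, one_mul] at h
    linear_combination h
  have hint01 : IntegrableOn (fun w : ℝ => adjTilde N z (w + 1)) (uIcc 0 1) volume := by
    rw [uIcc_of_le zero_le_one]
    exact (hh.mono Icc_subset_Ici_self).integrableOn_Icc
  have hprim := intervalIntegral.continuousOn_primitive_interval_left hint01
  rw [uIcc_of_le zero_le_one] at hprim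
  have h0 : (0:ℝ) ∈ Icc (0:ℝ) 1 := ⟨le_rfl, zero_le_one⟩
  have hT : Tendsto (fun s : ℝ => adjTilde N z 1 + z * ∫ w in s..1, adjTilde N z (w + 1))
      (𝓝[Icc 0 1] 0) (𝓝 (adjTilde N z 1 + z * ∫ w in (0:ℝ)..1, adjTilde N z (w + 1))) :=
    tendsto_const_nhds.add ((hprim 0 h0).tendsto.const_mul z)
  have hle : 𝓝[>] (0:ℝ) ≤ 𝓝[Icc 0 1] 0 := by
    rw [← nhdsWithin_Ioc_eq_nhdsGT zero_lt_one]
    exact nhdsWithin_mono _ Ioc_subset_Icc_self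
  refine (hT.mono_left hle).congr' ?_
  filter_upwards [Ioc_mem_nhdsGT zero_lt_one] with t ht
  exact (hFTC t ht).symm

/-! ## Step 2: the limit for `Re z > -1` (substitution `x = y/t`, `Ein = γ + log + E₁`, dominated
convergence) -/

/-- `γ + E₁(x) ≤ 1 + max(0, -log x)` for `x > 0` (`γ + E₁ x = Ein x - log x`, `Ein x ≤ x`, `Ein x ≤
1 + log x` for `x ≥ 1`). -/
theorem eulerMascheroni_add_expIntegralE1_le {x : ℝ} (hx : 0 < x) :
    Real.eulerMascheroniConstant + expIntegralE1 x ≤ 1 + max 0 (-Real.log x) := by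
  have h := Literature.NumberTheory.Sieve.ein_eq_add hx
  have h2 : Real.eulerMascheroniConstant + expIntegralE1 x = ein x - Real.log x := by linarith
  rw [h2]
  rcases le_or_gt 1 x with h1 | h1
  · have h3 := AdjEq.ein_le_one_add_log h1
    have h4 := le_max_left 0 (-Real.log x)
    linarith
  · have h3 := Literature.NumberTheory.Sieve.ein_le_self hx.le
    have h4 := le_max_right 0 (-Real.log x)
    linarith

/-- `exp(a · max(0, -log y)) ≤ 1 + y^{-a}` for `a ≥ 0`, `y > 0`. -/
theorem exp_mul_max_neg_log_le {a y : ℝ} (hy : 0 < y) :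
    Real.exp (a * max 0 (-Real.log y)) ≤ 1 + y ^ (-a) := by
  have hya : 0 ≤ y ^ (-a) := Real.rpow_nonneg hy.le _
  rcases le_or_gt 0 (Real.log y) with h | h
  · rw [max_eq_left (by linarith), mul_zero, Real.exp_zero]
    linarith
  · rw [max_eq_right (by linarith), Real.rpow_def_of_pos hy,
      show a * -Real.log y = Real.log y * (-a) by ring]
    linarith [Real.exp_pos (Real.log y * (-a))]

/-- The kernel on the positive reals in closed form: `x^z φ_z(x) = exp(-z (γ + E₁(x)))` for `x > 0`
(tree `Literature.NumberTheory.Sieve.ein_eq_add`: `Ein = γ + log + E₁`). -/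
theorem cpow_mul_phiZ_eq (hE : MGEin) (z : ℂ) {x : ℝ} (hx : 0 < x) :
    (x : ℂ) ^ z * phiZ z x =
      Complex.exp (-(z * ((Real.eulerMascheroniConstant + expIntegralE1 x : ℝ) : ℂ))) := by
  have hx0 : (x : ℂ) ≠ 0 := Complex.ofReal_ne_zero.mpr hx.ne'
  rw [AdjEq.phiZ_ofReal hE, Complex.cpow_def_of_ne_zero hx0, ← Complex.ofReal_log hx.le,
    ← Complex.exp_add, Literature.NumberTheory.Sieve.ein_eq_add hx]
  congr 1
  push_cast
  ring

/-- **Step 2 (the initial value on the half-plane).** For `Re z > -1`, `t · g̃_z(t) → Γ(1+z)⁻¹` as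
`t → 0⁺`: by (B) `t g̃_z(t) = e^{γz}Γ(1+z)⁻¹ t∫_0^∞ e^{-tx} x^z φ_z(x) dx = e^{γz}Γ(1+z)⁻¹ ∫_0^∞
e^{-y} exp(-z(γ + E₁(y/t))) dy → e^{γz}Γ(1+z)⁻¹ e^{-γz}` (`E₁(y/t) → 0`, dominated convergence with
the majorant `e · e^{-y}(1 + y^{-a})`, `a = max(0, -Re z) < 1`). -/
theorem tendsto_mul_adjTilde_of_re_gt (hE : MGEin) (N : ℕ) {z : ℂ} (hz : -1 < z.re) :
    Tendsto (fun t : ℝ => (t : ℂ) * adjTilde N z t) (𝓝[>] 0)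
      (𝓝 (Complex.Gamma (1 + z))⁻¹) := by
  set γ : ℝ := Real.eulerMascheroniConstant with hγ
  set c : ℂ := Complex.exp ((γ : ℂ) * z) * (Complex.Gamma (1 + z))⁻¹ with hc
  set G : ℝ → ℝ → ℂ := fun t y => Complex.exp (-(y : ℂ)) *
      Complex.exp (-(z * ((γ + expIntegralE1 (t⁻¹ * y) : ℝ) : ℂ))) with hG
  -- (i) the substitution `x = y/t`
  have hrepr : ∀ t : ℝ, 0 < t → (t : ℂ) * adjTilde N z t = c * ∫ y in Ioi (0:ℝ), G t y := by
    intro t ht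
    set g : ℝ → ℂ := fun x => Complex.exp (-((t : ℂ) * x)) * (x : ℂ) ^ z * phiZ z x with hg
    have hsub := integral_comp_mul_left_Ioi g 0 (inv_pos.mpr ht)
    rw [mul_zero, inv_inv] at hsub
    have hG' : EqOn (fun y => g (t⁻¹ * y)) (G t) (Ioi 0) := by
      intro y hy
      have hy' : 0 < y := hy
      have hY : 0 < t⁻¹ * y := mul_pos (inv_pos.mpr ht) hy'
      have ht0 : (t : ℂ) ≠ 0 := Complex.ofReal_ne_zero.mpr ht.ne'
      have h1 : (t : ℂ) * ((t⁻¹ * y : ℝ) : ℂ) = (y : ℂ) := by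
        push_cast
        rw [← mul_assoc, mul_inv_cancel₀ ht0, one_mul]
      simp only [hg, hG]
      rw [mul_assoc, cpow_mul_phiZ_eq hE z hY, h1]
    rw [AdjEq.adjTilde_eq_of_re_gt hE N hz ht, ← setIntegral_congr_fun measurableSet_Ioi hG', hsub,
      Complex.real_smul]
    ring
  -- (ii) dominated convergence
  have hγpos : 0 < γ := lt_trans one_half_pos Real.one_half_lt_eulerMascheroniConstant
  set a : ℝ := max 0 (-z.re) with ha
  have ha0 : 0 ≤ a := le_max_left _ _
  have ha1 : a < 1 := max_lt one_pos (by linarith)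
  have hE1cont : ContinuousOn expIntegralE1 (Ioi 0) := fun x hx =>
    (Literature.NumberTheory.Sieve.hasDerivAt_expIntegralE1 hx).continuousAt.continuousWithinAt
  set bound : ℝ → ℝ := fun y => Real.exp 1 * (Real.exp (-y) + Real.exp (-y) * y ^ (-a)) with hbound
  have hlim : Tendsto (fun t => ∫ y in Ioi (0:ℝ), G t y) (𝓝[>] 0)
      (𝓝 (∫ y in Ioi (0:ℝ), Complex.exp (-(y : ℂ)) * Complex.exp (-(z * (γ : ℂ))))) := by
    refine tendsto_integral_filter_of_dominated_convergence bound ?_ ?_ ?_ ?_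
    · filter_upwards [self_mem_nhdsWithin] with t (ht : 0 < t)
      refine ContinuousOn.aestronglyMeasurable ?_ measurableSet_Ioi
      have h1 : ContinuousOn (fun y : ℝ => expIntegralE1 (t⁻¹ * y)) (Ioi 0) :=
        hE1cont.comp (continuous_const.mul continuous_id).continuousOn fun y hy =>
          mul_pos (inv_pos.mpr ht) hy
      have h2 : ContinuousOn (fun y : ℝ => ((γ + expIntegralE1 (t⁻¹ * y) : ℝ) : ℂ)) (Ioi 0) :=
        Complex.continuous_ofReal.comp_continuousOn (continuousOn_const.add h1)
      exact (Continuous.continuousOn (by fun_prop)).mul ((continuousOn_const.mul h2).neg.cexp)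
    · filter_upwards [Ioc_mem_nhdsGT zero_lt_one] with t ht
      refine (ae_restrict_mem measurableSet_Ioi).mono fun y (hy : 0 < y) => ?_
      have hY : y ≤ t⁻¹ * y := by
        have : 1 ≤ t⁻¹ := one_le_inv_iff₀.mpr ⟨ht.1, ht.2⟩
        nlinarith
      have hY0 : 0 < t⁻¹ * y := lt_of_lt_of_le hy hY
      set r : ℝ := γ + expIntegralE1 (t⁻¹ * y) with hr
      have hE1nn : 0 ≤ expIntegralE1 (t⁻¹ * y) :=
        setIntegral_nonneg measurableSet_Ioi fun s (hs : t⁻¹ * y < s) =>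
          div_nonneg (Real.exp_pos _).le (hY0.trans hs).le
      have hr0 : 0 ≤ r := add_nonneg hγpos.le hE1nn
      have hr1 : r ≤ 1 + max 0 (-Real.log y) := by
        refine (eulerMascheroni_add_expIntegralE1_le hY0).trans ?_
        have := Real.log_le_log hy hY
        gcongr
      have hnorm : ‖G t y‖ = Real.exp (-y) * Real.exp (-(z.re * r)) := by
        simp only [hG, hr]
        rw [norm_mul, Complex.norm_exp, Complex.norm_exp]
        simp [Complex.mul_re]
      rw [hnorm, hbound]
      have hkey : Real.exp (-(z.re * r)) ≤ Real.exp 1 * (1 + y ^ (-a)) := by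
        have h1 : -(z.re * r) ≤ a * (1 + max 0 (-Real.log y)) := by
          calc -(z.re * r) = (-z.re) * r := by ring
            _ ≤ a * r := mul_le_mul_of_nonneg_right (le_max_right _ _) hr0
            _ ≤ a * (1 + max 0 (-Real.log y)) := mul_le_mul_of_nonneg_left hr1 ha0
        calc Real.exp (-(z.re * r)) ≤ Real.exp (a * (1 + max 0 (-Real.log y))) :=
              Real.exp_le_exp.mpr h1
          _ = Real.exp a * Real.exp (a * max 0 (-Real.log y)) := by rw [← Real.exp_add]; ring_nf
          _ ≤ Real.exp 1 * (1 + y ^ (-a)) :=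
              mul_le_mul (Real.exp_le_exp.mpr ha1.le) (exp_mul_max_neg_log_le hy)
                (Real.exp_pos _).le (Real.exp_pos _).le
      have he0 : 0 ≤ Real.exp (-y) := (Real.exp_pos _).le
      calc Real.exp (-y) * Real.exp (-(z.re * r)) ≤ Real.exp (-y) * (Real.exp 1 * (1 + y ^ (-a))) :=
            mul_le_mul_of_nonneg_left hkey he0
        _ = Real.exp 1 * (Real.exp (-y) + Real.exp (-y) * y ^ (-a)) := by ring
    · have hb1 : IntegrableOn (fun y : ℝ => Real.exp (-y)) (Ioi 0) := by
        simpa using exp_neg_integrableOn_Ioi 0 one_pos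
      have hb2 : IntegrableOn (fun y : ℝ => Real.exp (-y) * y ^ (-a)) (Ioi 0) := by
        have := Real.GammaIntegral_convergent (s := 1 - a) (by linarith)
        rwa [sub_sub_cancel_left] at this
      exact (hb1.add hb2).const_mul _
    · refine (ae_restrict_mem measurableSet_Ioi).mono fun y (hy : 0 < y) => ?_
      have hY : Tendsto (fun t : ℝ => t⁻¹ * y) (𝓝[>] 0) atTop :=
        tendsto_inv_nhdsGT_zero.atTop_mul_const hy
      have hE1 : Tendsto (fun t : ℝ => expIntegralE1 (t⁻¹ * y)) (𝓝[>] 0) (𝓝 0) :=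
        Literature.NumberTheory.Sieve.tendsto_expIntegralE1_atTop.comp hY
      have h1 : Tendsto (fun t : ℝ => ((γ + expIntegralE1 (t⁻¹ * y) : ℝ) : ℂ)) (𝓝[>] 0)
          (𝓝 ((γ : ℝ) : ℂ)) := by
        have h := (tendsto_const_nhds (x := γ)).add hE1
        rw [add_zero] at h
        exact (Complex.continuous_ofReal.tendsto γ).comp h
      simp only [hG]
      exact tendsto_const_nhds.mul ((tendsto_const_nhds.mul h1).neg.cexp)
  -- (iii) the value of the limit
  have hI1 : ∫ y in Ioi (0:ℝ), Complex.exp (-(y : ℂ)) = 1 := by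
    have h1 : (fun y : ℝ => Complex.exp (-(y : ℂ))) = fun y : ℝ => ((Real.exp (-y) : ℝ) : ℂ) := by
      funext y
      rw [Complex.ofReal_exp]
      push_cast
      rfl
    rw [h1, integral_complex_ofReal, integral_exp_neg_Ioi_zero]
    simp
  have hfin : c * ∫ y in Ioi (0:ℝ), Complex.exp (-(y : ℂ)) * Complex.exp (-(z * (γ : ℂ))) =
      (Complex.Gamma (1 + z))⁻¹ := by
    rw [integral_mul_const, hI1, one_mul, hc, mul_comm (Complex.exp _) _,
      mul_assoc, ← Complex.exp_add, show (γ : ℂ) * z + -(z * γ) = 0 by ring, Complex.exp_zero,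
      mul_one]
  rw [← hfin]
  refine (hlim.const_mul c).congr' ?_
  filter_upwards [self_mem_nhdsWithin] with t ht
  exact (hrepr t ht).symm

end InvVal

/-- **The invariant's value on the half-plane** (registered helper for the stub `mg_invariantValue`,
line `dip-margin-rate-exchange`): for `N ≥ 1`, `|z| ≤ N - 1` and `Re z > -1`, `g̃_z(1) + z ∫_0^1
g̃_z(t+1) dt = 1/Γ(1+z)` (both sides are `lim_{t→0⁺} t g̃_z(t)`: Step 1 by the adjoint equation,
Step 2 by the substitution `x = y/t` and `Ein = γ + log + E₁`). -/
theorem mg_invariantValue_halfplane : MGEin → MGAdjointEq → ∀ N : ℕ, 1 ≤ N → ∀ z : ℂ, ‖z‖ ≤ (N : ℝ) - 1 → -1 < z.re → adjTilde N z 1 + z * ∫ t in (0 : ℝ)..1, adjTilde N z (t + 1) = (Complex.Gamma (1 + z))⁻¹ :=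
  fun hE hEq _ hN _ hz hre =>
    tendsto_nhds_unique (InvVal.tendsto_mul_adjTilde_of_adjointEq hEq hN hz)
      (InvVal.tendsto_mul_adjTilde_of_re_gt hE _ hre)

end Summit.Parity.GeneralizedHardyLittlewood.Cruxes.AbsoluteUpgrade.DipMarginRateExchange

end
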